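import Summits.Ventures.PercRepro.S1JointEngineAB

/-!
# PercRepro — S1 PROPOSITION A WITH THE FLAT PROFILE (LEMMAS A + B): the instances (p2, gen 16; SUBCLAIM-S1 §4
(A12)–(A13))

The three-class count `S1JointEngineAB.ncard_rank4_Icc_le_engine` instantiated with LEMMA A (`S1FlatBudget`): at
corank `d ≤ 6` at most one flat has `≥ 9` points (threshold `9`, the eight-point flats at `RM c`); at `d ≤ 7` at most
one has `10` (threshold `10`, the eight- and nine-point flats at `RB9 c`); and folded with lever L1.

* **`ncard_rank4_Icc_le_AB6`**, **`ncard_rank4_Icc_le_AB7`** — the counts;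
* **`ncard_eRk_eq_four_ncard_le_le_AB6`**, **`ncard_eRk_eq_four_ncard_le_le_AB7`** — the Proposition-A forms with L1.
Axioms: standard.
-/

open scoped Matroid

namespace PercRepro

namespace S1

open Set

variable {α : Type}

/-- **THE COUNT AT CORANK `d ≤ 6`** (`t = 9`, eight-point flats at `RM c`, at most one flat with `≥ 9` points). -/
theorem ncard_rank4_Icc_le_AB6 (M : Matroid α) [M.Finite]
    (hcirc : ∀ C, M.IsCircuit C → 3 ≤ C.encard)
    (hline : ∀ L ⊆ M.E, M.eRk L ≤ 2 → L.ncard ≤ 3) (hplane : ∀ P ⊆ M.E, M.eRk P ≤ 3 → P.ncard ≤ 6)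
    (hten : ∀ X ⊆ M.E, M.eRk X ≤ 4 → X.ncard ≤ 10) {d : ℕ} (hd : M.E.encard = M.eRank + d) (hd6 : d ≤ 6)
    (c : ℕ) :
    7560 * {B : Set α | B ⊆ M.E ∧ M.eRk B = 4 ∧ 5 ≤ B.ncard ∧ B.ncard ≤ c}.ncard ≤
      RSK c * ({C : Set α | M.IsCircuit C ∧ C.ncard = 3}.ncard * (M.E.ncard - 3).choose 2 +
        {C : Set α | M.IsCircuit C ∧ C.ncard = 4}.ncard * (M.E.ncard - 4) +
        {C : Set α | M.IsCircuit C ∧ C.ncard = 5}.ncard) +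
      (RM c - RSK c) * ({C : Set α | M.IsCircuit C ∧ C.ncard = 3}.ncard * (min (5 * d) M.E.ncard - 3).choose 2 +
        {C : Set α | M.IsCircuit C ∧ C.ncard = 4}.ncard * (min (5 * d) M.E.ncard - 4) +
        {C : Set α | M.IsCircuit C ∧ C.ncard = 5}.ncard) +
      7560 * betaK 10 c := by
  have h := ncard_rank4_Icc_le_engine M hcirc hline hplane hten c 9 (RM c) 1 (min (5 * d) M.E.ncard)
    (ncard_sUnion_circuitsLE_le_min M hd) ?_ ?_
  · simpa only [one_mul] using h
  · intro F hF hcl hr h8 h9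
    exact weight_eight_AB M hcirc hline hplane hF hcl hr (by omega) c
  · intro fl hfl
    rw [Finset.card_le_one]
    intro F hF F' hF'
    obtain ⟨hFE, hcl, hr, h9⟩ := hfl F hF
    obtain ⟨hFE', hcl', hr', h9'⟩ := hfl F' hF'
    exact eq_of_nine_le_ncard_of_flats M hline hplane hd hd6 hFE hcl hr hFE' hcl' hr' h9 h9'

/-- **THE COUNT AT CORANK `d ≤ 7`** (`t = 10`, eight- and nine-point flats at `RB9 c`, at most one ten-point flat). -/
theorem ncard_rank4_Icc_le_AB7 (M : Matroid α) [M.Finite]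
    (hcirc : ∀ C, M.IsCircuit C → 3 ≤ C.encard)
    (hline : ∀ L ⊆ M.E, M.eRk L ≤ 2 → L.ncard ≤ 3) (hplane : ∀ P ⊆ M.E, M.eRk P ≤ 3 → P.ncard ≤ 6)
    (hten : ∀ X ⊆ M.E, M.eRk X ≤ 4 → X.ncard ≤ 10) {d : ℕ} (hd : M.E.encard = M.eRank + d) (hd7 : d ≤ 7)
    (c : ℕ) :
    7560 * {B : Set α | B ⊆ M.E ∧ M.eRk B = 4 ∧ 5 ≤ B.ncard ∧ B.ncard ≤ c}.ncard ≤
      RSK c * ({C : Set α | M.IsCircuit C ∧ C.ncard = 3}.ncard * (M.E.ncard - 3).choose 2 +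
        {C : Set α | M.IsCircuit C ∧ C.ncard = 4}.ncard * (M.E.ncard - 4) +
        {C : Set α | M.IsCircuit C ∧ C.ncard = 5}.ncard) +
      (RB9 c - RSK c) * ({C : Set α | M.IsCircuit C ∧ C.ncard = 3}.ncard * (min (5 * d) M.E.ncard - 3).choose 2 +
        {C : Set α | M.IsCircuit C ∧ C.ncard = 4}.ncard * (min (5 * d) M.E.ncard - 4) +
        {C : Set α | M.IsCircuit C ∧ C.ncard = 5}.ncard) +
      7560 * betaK 10 c := by
  have h := ncard_rank4_Icc_le_engine M hcirc hline hplane hten c 10 (RB9 c) 1 (min (5 * d) M.E.ncard)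
    (ncard_sUnion_circuitsLE_le_min M hd) ?_ ?_
  · simpa only [one_mul] using h
  · intro F hF hcl hr h8 h10
    have h89 : F.ncard = 8 ∨ F.ncard = 9 := by omega
    rcases h89 with h | h
    · have hRM : RM c ≤ RB9 c := by
        unfold RM RB9
        have h1 : betaK 8 c ≤ betaK 9 c := betaK_le_betaK_of_le (by norm_num) c
        -- `158·βK_c(8) ≤ 100·βK_c(9)`: termwise `158·C(8, j) ≤ 100·C(9, j)` for `j ≥ 6`
        have h2 : 158 * betaK 8 c ≤ 100 * betaK 9 c := by
          unfold betaK
          rw [Finset.mul_sum, Finset.mul_sum]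
          calc ∑ j ∈ Finset.Icc 6 (min 8 c), 158 * Nat.choose 8 j
              ≤ ∑ j ∈ Finset.Icc 6 (min 8 c), 100 * Nat.choose 9 j := by
                apply Finset.sum_le_sum
                intro j hj
                rw [Finset.mem_Icc] at hj
                have hj8 : j ≤ 8 := hj.2.trans (min_le_left _ _)
                have hj6 : 6 ≤ j := hj.1
                interval_cases j <;> decide
            _ ≤ ∑ j ∈ Finset.Icc 6 (min 9 c), 100 * Nat.choose 9 j := by
                apply Finset.sum_le_sum_of_subset_of_nonneg
                · intro j hj
                  rw [Finset.mem_Icc] at hj ⊢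
                  exact ⟨hj.1, hj.2.trans (min_le_min_right c (by norm_num))⟩
                · intros; exact Nat.zero_le _
        omega
      exact (weight_eight_AB M hcirc hline hplane hF hcl hr h c).trans (Nat.mul_le_mul_right _ hRM)
    · exact weight_nine_AB M hline hplane hF hcl hr h c
  · intro fl hfl
    rw [Finset.card_le_one]
    intro F hF F' hF'
    obtain ⟨hFE, hcl, hr, h10⟩ := hfl F hF
    obtain ⟨hFE', hcl', hr', h10'⟩ := hfl F' hF'
    exact eq_of_ten_le_ncard_of_flats M hline hplane hd hd7 hFE hcl hr hFE' hcl' hr' h10 h10'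

/-- **PROPOSITION A, LEMMAS J + J′ + K + L1 + A + B AT `d ≤ 6`**: `7560·#{B : r(B) = 4, |B| ≤ d} + 7560·(s₃(n − 3) + s₄)
≤ 7560·C(n, 4) + RSK d·Π′_all + (RM d − RSK d)·Π′_{S₀} + 7560·βK_d(10)`. -/
theorem ncard_eRk_eq_four_ncard_le_le_AB6 (M : Matroid α) [M.Finite]
    (hcirc : ∀ C, M.IsCircuit C → 3 ≤ C.encard)
    (hline : ∀ L ⊆ M.E, M.eRk L ≤ 2 → L.ncard ≤ 3) (hplane : ∀ P ⊆ M.E, M.eRk P ≤ 3 → P.ncard ≤ 6)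
    (hten : ∀ X ⊆ M.E, M.eRk X ≤ 4 → X.ncard ≤ 10) {d : ℕ} (hd : M.E.encard = M.eRank + d) (hd6 : d ≤ 6) :
    7560 * {B : Set α | B ⊆ M.E ∧ M.eRk B = 4 ∧ B.ncard ≤ d}.ncard +
      7560 * ({C : Set α | M.IsCircuit C ∧ C.ncard = 3}.ncard * (M.E.ncard - 3) +
        {C : Set α | M.IsCircuit C ∧ C.ncard = 4}.ncard) ≤
      7560 * M.E.ncard.choose 4 +
      RSK d * ({C : Set α | M.IsCircuit C ∧ C.ncard = 3}.ncard * (M.E.ncard - 3).choose 2 +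
        {C : Set α | M.IsCircuit C ∧ C.ncard = 4}.ncard * (M.E.ncard - 4) +
        {C : Set α | M.IsCircuit C ∧ C.ncard = 5}.ncard) +
      (RM d - RSK d) * ({C : Set α | M.IsCircuit C ∧ C.ncard = 3}.ncard * (min (5 * d) M.E.ncard - 3).choose 2 +
        {C : Set α | M.IsCircuit C ∧ C.ncard = 4}.ncard * (min (5 * d) M.E.ncard - 4) +
        {C : Set α | M.IsCircuit C ∧ C.ncard = 5}.ncard) +
      7560 * betaK 10 d := by
  classical
  have hcore := ncard_rank4_Icc_le_AB6 M hcirc hline hplane hten hd hd6 d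
  set S₁ := {B : Set α | B ⊆ M.E ∧ B.ncard = 4 ∧ M.eRk B = 4} with hS₁
  set S₂ := {B : Set α | B ⊆ M.E ∧ M.eRk B = 4 ∧ 5 ≤ B.ncard ∧ B.ncard ≤ d} with hS₂
  have hsplit : {B : Set α | B ⊆ M.E ∧ M.eRk B = 4 ∧ B.ncard ≤ d} ⊆ S₁ ∪ S₂ := by
    intro B hB
    have hBfin : B.Finite := M.ground_finite.subset hB.1
    have hle : 4 ≤ B.ncard := by
      have := M.eRk_le_encard B
      rw [hB.2.1, ← hBfin.cast_ncard_eq] at this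
      exact_mod_cast this
    rcases hle.lt_or_eq with h | h
    · exact Or.inr ⟨hB.1, hB.2.1, h, hB.2.2⟩
    · exact Or.inl ⟨hB.1, h.symm, hB.2.1⟩
  have hS₁fin : S₁.Finite := M.ground_finite.finite_subsets.subset (fun B hB => hB.1)
  have hS₂fin : S₂.Finite := M.ground_finite.finite_subsets.subset (fun B hB => hB.1)
  have hS₁card := ncard_four_sets_rank_four_add_le M hline
  have h1 : 7560 * {B : Set α | B ⊆ M.E ∧ M.eRk B = 4 ∧ B.ncard ≤ d}.ncard ≤ 7560 * (S₁.ncard + S₂.ncard) :=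
    calc 7560 * {B : Set α | B ⊆ M.E ∧ M.eRk B = 4 ∧ B.ncard ≤ d}.ncard
        ≤ 7560 * (S₁ ∪ S₂).ncard :=
          Nat.mul_le_mul_left _ (Set.ncard_le_ncard hsplit (hS₁fin.union hS₂fin))
      _ ≤ 7560 * (S₁.ncard + S₂.ncard) := Nat.mul_le_mul_left _ (Set.ncard_union_le _ _)
  have h2 : 7560 * (S₁.ncard + ({C : Set α | M.IsCircuit C ∧ C.ncard = 3}.ncard * (M.E.ncard - 3) +
      {C : Set α | M.IsCircuit C ∧ C.ncard = 4}.ncard)) ≤ 7560 * M.E.ncard.choose 4 :=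
    Nat.mul_le_mul_left _ hS₁card
  have := hcore
  rw [Nat.mul_add] at h1 h2
  omega

/-- **PROPOSITION A, LEMMAS J + J′ + K + L1 + A + B AT `d ≤ 7`**: the same with `RB9 d` in place of `RM d`. -/
theorem ncard_eRk_eq_four_ncard_le_le_AB7 (M : Matroid α) [M.Finite]
    (hcirc : ∀ C, M.IsCircuit C → 3 ≤ C.encard)
    (hline : ∀ L ⊆ M.E, M.eRk L ≤ 2 → L.ncard ≤ 3) (hplane : ∀ P ⊆ M.E, M.eRk P ≤ 3 → P.ncard ≤ 6)
    (hten : ∀ X ⊆ M.E, M.eRk X ≤ 4 → X.ncard ≤ 10) {d : ℕ} (hd : M.E.encard = M.eRank + d) (hd7 : d ≤ 7) :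
    7560 * {B : Set α | B ⊆ M.E ∧ M.eRk B = 4 ∧ B.ncard ≤ d}.ncard +
      7560 * ({C : Set α | M.IsCircuit C ∧ C.ncard = 3}.ncard * (M.E.ncard - 3) +
        {C : Set α | M.IsCircuit C ∧ C.ncard = 4}.ncard) ≤
      7560 * M.E.ncard.choose 4 +
      RSK d * ({C : Set α | M.IsCircuit C ∧ C.ncard = 3}.ncard * (M.E.ncard - 3).choose 2 +
        {C : Set α | M.IsCircuit C ∧ C.ncard = 4}.ncard * (M.E.ncard - 4) +
        {C : Set α | M.IsCircuit C ∧ C.ncard = 5}.ncard) +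
      (RB9 d - RSK d) * ({C : Set α | M.IsCircuit C ∧ C.ncard = 3}.ncard * (min (5 * d) M.E.ncard - 3).choose 2 +
        {C : Set α | M.IsCircuit C ∧ C.ncard = 4}.ncard * (min (5 * d) M.E.ncard - 4) +
        {C : Set α | M.IsCircuit C ∧ C.ncard = 5}.ncard) +
      7560 * betaK 10 d := by
  classical
  have hcore := ncard_rank4_Icc_le_AB7 M hcirc hline hplane hten hd hd7 d
  set S₁ := {B : Set α | B ⊆ M.E ∧ B.ncard = 4 ∧ M.eRk B = 4} with hS₁
  set S₂ := {B : Set α | B ⊆ M.E ∧ M.eRk B = 4 ∧ 5 ≤ B.ncard ∧ B.ncard ≤ d} with hS₂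
  have hsplit : {B : Set α | B ⊆ M.E ∧ M.eRk B = 4 ∧ B.ncard ≤ d} ⊆ S₁ ∪ S₂ := by
    intro B hB
    have hBfin : B.Finite := M.ground_finite.subset hB.1
    have hle : 4 ≤ B.ncard := by
      have := M.eRk_le_encard B
      rw [hB.2.1, ← hBfin.cast_ncard_eq] at this
      exact_mod_cast this
    rcases hle.lt_or_eq with h | h
    · exact Or.inr ⟨hB.1, hB.2.1, h, hB.2.2⟩
    · exact Or.inl ⟨hB.1, h.symm, hB.2.1⟩
  have hS₁fin : S₁.Finite := M.ground_finite.finite_subsets.subset (fun B hB => hB.1)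
  have hS₂fin : S₂.Finite := M.ground_finite.finite_subsets.subset (fun B hB => hB.1)
  have hS₁card := ncard_four_sets_rank_four_add_le M hline
  have h1 : 7560 * {B : Set α | B ⊆ M.E ∧ M.eRk B = 4 ∧ B.ncard ≤ d}.ncard ≤ 7560 * (S₁.ncard + S₂.ncard) :=
    calc 7560 * {B : Set α | B ⊆ M.E ∧ M.eRk B = 4 ∧ B.ncard ≤ d}.ncard
        ≤ 7560 * (S₁ ∪ S₂).ncard :=
          Nat.mul_le_mul_left _ (Set.ncard_le_ncard hsplit (hS₁fin.union hS₂fin))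
      _ ≤ 7560 * (S₁.ncard + S₂.ncard) := Nat.mul_le_mul_left _ (Set.ncard_union_le _ _)
  have h2 : 7560 * (S₁.ncard + ({C : Set α | M.IsCircuit C ∧ C.ncard = 3}.ncard * (M.E.ncard - 3) +
      {C : Set α | M.IsCircuit C ∧ C.ncard = 4}.ncard)) ≤ 7560 * M.E.ncard.choose 4 :=
    Nat.mul_le_mul_left _ hS₁card
  have := hcore
  rw [Nat.mul_add] at h1 h2
  omega

end S1

end PercRepro
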